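import Summits.ResolutionOfSingularities.ResolutionOfSingularities.Theorems.MarkedTransferCampaignW53StratifiedDatum

/-!
# [OURS · L1 W5.3, variant (A)] Anchors for `MarkedTransferCampaignW53StratifiedDatum.lean` — vacuity made kernel,
# reduction to the enclosure criterion at non-isolated points, DEAD-criteria shapes for kill test K5.3b; THEOREMS ONLY
# (pure logic / elementary algebra over the sibling's vocabulary); NOT statements of the manuscript

Cell `res-hironaka`, LADDER-RESOLUTION rung L (rescue), RESCUE-SEED slot W5.3, variant (A) — companion of the OURS
definition file `MarkedTransferCampaignW53StratifiedDatum.lean` (OURS typer o5, p488358, filed on res-plan-2's word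
HOME/STATUS 2026-08-27T00:39:49Z). Nothing here defines anything and nothing here is a statement of H. Hironaka's
manuscript [Hironaka2017]; every theorem is a one-step consequence of the definitions, recorded BY NAME so that a
kill-test seat (res-plan-2's «next k-test if a seat frees: K5.3b = the negation of `StratConormalAdmissibleAt` at a
NON-isolated stratum point») and the lanes can cite instead of re-deriving. AI review is weaker than expert review.

## What is proved (ns `…Theorems.CampaignW53` unless top-level)

* VACUITY (ii) of the definition file, as a kernel fact: `stratumConormalSpaceAt_eq_top_of_maximalIdeal_le` — if
  `𝔪_ξ ≤ I(Σ̄_ξ)_ξ` (the stratum closure is the reduced point `ξ` near `ξ`, i.e. `ξ` is isolated in its stratum),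
  the stratum conormal space is the whole cotangent space; hence `stratConormalAdmissibleAt_of_maximalIdeal_le`
  (the criterion holds for EVERY `vbar`) and `cond119Strat_of_maximalIdeal_le` ((119)^h-relative-to-the-stratum asks
  only `h_j ∈ 𝔪_ξ · 𝒪_{U,u}`, which (1)^h/(4)^h already give via `Cond4`).
* REDUCTION at points where the stratum closure and `closure Sing(Ě)` have the same ideal stalk (the generic point of
  a NON-isolated stratum of top dimension, e.g. every point of the W-Q curve `γ` other than `η₀`):
  `stratumConormalSpaceAt_eq_conormalSpaceAt_of_eq`, `stratConormalAdmissibleAt_iff_of_eq`,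
  `cond119Strat_iff_cond119_of_eq`, `datumStratAt_iff_datumEncAt_of_eq` — there (A)'s criterion IS K5.3's enclosure
  criterion (which K5.3 §3 found satisfied along `γ ∖ {η₀}`), so K5.3b needs a witness OTHER than W-Q.
* DEAD-criteria shapes: `not_stratConormalAdmissibleAt_of_mem_not_mem` (one cotangent class of the exponent that is
  NOT conormal to the stratum closure), `datumStratAt_mono` (monotone in the bound `N`),
  `not_campaignW53StratifiedDatumOf_of_forall_not` (pointwise failure for every `N` at one closed singular point
  refutes the slot statement).

HONEST FRAMING. The link «`DatumStratAt … ξ N` for some `N` ⟹ `StratConormalAdmissibleAt Ec vbar ξ`» (pull-back of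
the U-side containment along the cotangent map of an étale neighbourhood with trivial residue extension) is NOT proved
here — it needs the isomorphism `𝔪_ξ/𝔪_ξ² ≅ 𝔪_u/𝔪_u²` for such neighbourhoods, a genuine algebraic-geometry lemma (K5.3
argued it in the completion); a K5.3b certificate against `StratConormalAdmissibleAt` therefore scores the CRITERION,
and scores `CampaignW53StratifiedDatumOf` only together with that lemma. Nothing here takes a side.

References (orientation only): the definition file and its sibling (o5, p488358 / p465727); L/res-L1-k53/KILL-TEST-K5.3.md
§3–§5 (p466131); plan/RESCUE-SEED.md v0.6.6 §1 W5.3. [Hironaka2017] is named for the ROLE replaced, never as a fact.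
-/

noncomputable section

set_option linter.dupNamespace false -- mandated namespace of this single-conjunct summit

open _root_.CategoryTheory _root_.AlgebraicGeometry _root_.TopologicalSpace IsLocalRing
open Literature.AlgebraicGeometry.Resolution
open Literature.AlgebraicGeometry.Hironaka2017.S02Preliminaries
open Literature.AlgebraicGeometry.Hironaka2017.S15ARSchemes

namespace Summit.ResolutionOfSingularities.ResolutionOfSingularities.Theorems

universe u

namespace CampaignW53

variable {p : ℕ} [Fact p.Prime] {K : Type u} [Field K] [CharP K p] {A : AmbientDatum p K}
variable {ℓ : ℕ} {Ec : IdealExponent A.Z} {cot : ∀ η : A.Z, Set (A.Z.presheaf.stalk η)}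
  {vbar : ∀ ξ : A.Z, Submodule (ResidueField (A.Z.presheaf.stalk ξ)) (CotangentSpace (A.Z.presheaf.stalk ξ))}

/-! ## Vacuity at points isolated in their stratum (VACUITY (ii) of the definition file, made kernel) -/

/-- OURS [L1 W5.3 (A)] anchor (elementary algebra; not a statement of the manuscript). If the maximal ideal `𝔪_ξ`
lies in the ideal stalk `I(Σ̄_ξ)_ξ` of the stratum closure through `ξ` (the case `Σ̄_ξ = {ξ}` near `ξ`: `ξ` isolated in
its embedding-dimension stratum, e.g. the W-Q point `η₀`), then the stratum conormal space at `ξ` is the WHOLE cotangent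
space `𝔪_ξ/𝔪_ξ²` (every class has a representative in `𝔪_ξ ⊆ I(Σ̄_ξ)_ξ`; `Ideal.toCotangent_surjective`). [folklore] -/
theorem stratumConormalSpaceAt_eq_top_of_maximalIdeal_le (ξ : A.Z)
    (h : maximalIdeal (A.Z.presheaf.stalk ξ) ≤
      stalkIdeal (_root_.AlgebraicGeometry.Scheme.IdealSheafData.vanishingIdeal (edimStratumClosure Ec ξ)) ξ) :
    stratumConormalSpaceAt Ec ξ = ⊤ := by
  refine eq_top_iff.2 fun v _ => Submodule.subset_span ?_
  obtain ⟨x, rfl⟩ := (maximalIdeal (A.Z.presheaf.stalk ξ)).toCotangent_surjective v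
  exact ⟨x, h x.2, rfl⟩

/-- OURS [L1 W5.3 (A)] anchor (not a statement of the manuscript). At a point isolated in its stratum
(`𝔪_ξ ≤ I(Σ̄_ξ)_ξ`) the stratum criterion `StratConormalAdmissibleAt Ec vbar ξ` holds for EVERY cotangent family
`vbar` — the automatic truth the definition file declares (VACUITY (ii)); all content of variant (A) at such points is
the consumer's noetherian induction, not typed. [folklore] -/
theorem stratConormalAdmissibleAt_of_maximalIdeal_le (ξ : A.Z)
    (h : maximalIdeal (A.Z.presheaf.stalk ξ) ≤
      stalkIdeal (_root_.AlgebraicGeometry.Scheme.IdealSheafData.vanishingIdeal (edimStratumClosure Ec ξ)) ξ) :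
    StratConormalAdmissibleAt Ec vbar ξ := by
  rw [StratConormalAdmissibleAt, stratumConormalSpaceAt_eq_top_of_maximalIdeal_le ξ h]
  exact le_top

/-- OURS [L1 W5.3 (A)] anchor (not a statement of the manuscript). At a point isolated in its stratum
(`𝔪_ξ ≤ I(Σ̄_ξ)_ξ`), (119)^h relative to the stratum asks only that every germ `h_j` lie in `𝔪_ξ · 𝒪_{U,u}`
(`(maximalIdeal 𝒪_{Z,ξ}).map φ`): `Ideal.map_mono`. For an étale (hence unramified) neighbourhood `𝔪_ξ · 𝒪_{U,u} = 𝔪_u`,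
so this is what (4)^h (`Cond4`: `h_j ∈ 𝔪_u`) supplies; the lemma takes the membership itself as the hypothesis and
assumes no unramifiedness. [folklore] -/
theorem cond119Strat_of_maximalIdeal_le {ξ : A.Z} (D : HenselianDatum A ξ)
    (h : maximalIdeal (A.Z.presheaf.stalk (D.e.base D.u)) ≤
      stalkIdeal (_root_.AlgebraicGeometry.Scheme.IdealSheafData.vanishingIdeal
        (edimStratumClosure Ec (D.e.base D.u))) (D.e.base D.u))
    (hm : ∀ j, D.h j ∈ (maximalIdeal (A.Z.presheaf.stalk (D.e.base D.u))).map D.φ) :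
    Cond119Strat Ec D :=
  fun j => Ideal.map_mono h (hm j)

/-! ## Reduction to the enclosure criterion where the stratum closure has the same ideal stalk as `closure Sing(Ě)` -/

/-- OURS [L1 W5.3 (A)] anchor (not a statement of the manuscript). If the ideal stalks at `ξ` of the stratum closure
`Σ̄_ξ` and of `closure Sing(Ě)` COINCIDE (the case of a point in the interior of a top-dimensional stratum — e.g. every
point of the W-Q curve `γ` except `η₀`, where `Σ̄ = γ = Sing(E_W)_red`), then the stratum conormal space IS the conormal
space `V_adm(ξ)` of the sibling. [folklore] -/
theorem stratumConormalSpaceAt_eq_conormalSpaceAt_of_eq (ξ : A.Z)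
    (h : stalkIdeal (_root_.AlgebraicGeometry.Scheme.IdealSheafData.vanishingIdeal (edimStratumClosure Ec ξ)) ξ =
      stalkIdeal (_root_.AlgebraicGeometry.Scheme.IdealSheafData.vanishingIdeal
        (⟨closure Ec.sing, isClosed_closure⟩ : Closeds A.Z)) ξ) :
    stratumConormalSpaceAt Ec ξ = conormalSpaceAt Ec ξ := by
  simp only [stratumConormalSpaceAt, conormalSpaceAt, h]

/-- OURS [L1 W5.3 (A)] anchor (not a statement of the manuscript). Under the same coincidence of ideal stalks, (A)'s
criterion `StratConormalAdmissibleAt` is EQUIVALENT to K5.3's enclosure criterion `ConormalAdmissibleAt` at `ξ` — so on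
the W-Q witness, along `γ ∖ {η₀}`, K5.3b asks exactly what K5.3 §3 already found satisfied; a K5.3b kill needs a
witness with a cotangent class transverse to a NON-isolated stratum. [folklore] -/
theorem stratConormalAdmissibleAt_iff_of_eq (ξ : A.Z)
    (h : stalkIdeal (_root_.AlgebraicGeometry.Scheme.IdealSheafData.vanishingIdeal (edimStratumClosure Ec ξ)) ξ =
      stalkIdeal (_root_.AlgebraicGeometry.Scheme.IdealSheafData.vanishingIdeal
        (⟨closure Ec.sing, isClosed_closure⟩ : Closeds A.Z)) ξ) :
    StratConormalAdmissibleAt Ec vbar ξ ↔ ConormalAdmissibleAt Ec vbar ξ := by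
  rw [StratConormalAdmissibleAt, ConormalAdmissibleAt, stratumConormalSpaceAt_eq_conormalSpaceAt_of_eq ξ h]

/-- OURS [L1 W5.3 (A)] anchor (not a statement of the manuscript). Under the coincidence of ideal stalks at the base
point of a henselian datum, (119)^h relative to the stratum is EQUIVALENT to the sibling's (119)^h. [folklore] -/
theorem cond119Strat_iff_cond119_of_eq {ξ : A.Z} (D : HenselianDatum A ξ)
    (h : stalkIdeal (_root_.AlgebraicGeometry.Scheme.IdealSheafData.vanishingIdeal
        (edimStratumClosure Ec (D.e.base D.u))) (D.e.base D.u) =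
      stalkIdeal (_root_.AlgebraicGeometry.Scheme.IdealSheafData.vanishingIdeal
        (⟨closure Ec.sing, isClosed_closure⟩ : Closeds A.Z)) (D.e.base D.u)) :
    Cond119Strat Ec D ↔ Cond119 Ec D := by
  simp only [Cond119Strat, Cond119, HenselianDatum.stratumIdeal, HenselianDatum.singIdeal, h]

/-- OURS [L1 W5.3 (A)] anchor (not a statement of the manuscript). Under the coincidence of ideal stalks at `ξ`
(for every datum based at `ξ`), the stratified local predicate `DatumStratAt` is EQUIVALENT to the sibling's enclosure
predicate `DatumEncAt` with the same bound. [folklore] -/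
theorem datumStratAt_iff_datumEncAt_of_eq {IsCanonical : ∀ ξ : A.Z, HenselianDatum A ξ → Prop} {ξ : A.Z} {N : ℕ}
    (h : ∀ D : HenselianDatum A ξ,
      stalkIdeal (_root_.AlgebraicGeometry.Scheme.IdealSheafData.vanishingIdeal
          (edimStratumClosure Ec (D.e.base D.u))) (D.e.base D.u) =
        stalkIdeal (_root_.AlgebraicGeometry.Scheme.IdealSheafData.vanishingIdeal
          (⟨closure Ec.sing, isClosed_closure⟩ : Closeds A.Z)) (D.e.base D.u)) :
    DatumStratAt ℓ Ec cot vbar IsCanonical ξ N ↔ DatumEncAt ℓ Ec cot vbar IsCanonical ξ N := by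
  refine ⟨fun ⟨D, hN, h1, h2, h4, h119, hc⟩ =>
      ⟨D, hN, h1, h2, h4, (cond119Strat_iff_cond119_of_eq D (h D)).1 h119, hc⟩,
    fun hD => datumStratAt_of_datumEncAt hD⟩

/-! ## DEAD-criteria shapes (what a K5.3b certificate instantiates) -/

/-- OURS [L1 W5.3 (A)] anchor (not a statement of the manuscript). **K5.3b certificate shape**: ONE cotangent class
`v ∈ 𝔳̄(E)_ξ` that does NOT lie in the conormal space of the stratum closure at `ξ` (i.e. is not the class of an element
of `I(Σ̄_ξ)_ξ`, equivalently does not kill the Zariski tangent space of `Σ̄_ξ` at `ξ`) refutes the stratum criterion at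
`ξ`. [folklore] -/
theorem not_stratConormalAdmissibleAt_of_mem_not_mem {ξ : A.Z} (v : CotangentSpace (A.Z.presheaf.stalk ξ))
    (hv : v ∈ vbar ξ) (hnot : v ∉ stratumConormalSpaceAt Ec ξ) : ¬ StratConormalAdmissibleAt Ec vbar ξ :=
  fun h => hnot (h hv)

/-- OURS [L1 W5.3 (A)] anchor (pure logic; not a statement of the manuscript). The stratified local predicate is
monotone in the bound: a datum with `≤ M` members is one with `≤ N` members for `M ≤ N`. [folklore] -/
theorem datumStratAt_mono {IsCanonical : ∀ ξ : A.Z, HenselianDatum A ξ → Prop} {ξ : A.Z} {M N : ℕ} (hMN : M ≤ N)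
    (h : DatumStratAt ℓ Ec cot vbar IsCanonical ξ M) : DatumStratAt ℓ Ec cot vbar IsCanonical ξ N := by
  obtain ⟨D, hM, h1, h2, h4, h119, hc⟩ := h
  exact ⟨D, hM.trans hMN, h1, h2, h4, h119, hc⟩

end CampaignW53

/-- OURS [L1 W5.3 (A)] anchor (pure logic; not a statement of the manuscript). **DEAD instance shape for the slot
statement**: if at ONE closed point `ξ ∈ Sing(Ě)` the stratified local datum fails for EVERY bound `N`, then
`CampaignW53StratifiedDatumOf A ℓ Ec cot vbar IsCanonical` fails (at the given parameters). A K5.3b certificate against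
the CRITERION `StratConormalAdmissibleAt` yields this hypothesis only together with the cotangent-isomorphism lemma for
étale neighbourhoods with trivial residue extension (module docstring, HONEST FRAMING) — not proved here. [folklore] -/
theorem not_campaignW53StratifiedDatumOf_of_forall_not {p : ℕ} [Fact p.Prime] {K : Type u} [Field K] [CharP K p]
    [PerfectField K] {A : AmbientDatum p K} {ℓ : ℕ} {Ec : IdealExponent A.Z}
    {cot : ∀ η : A.Z, Set (A.Z.presheaf.stalk η)}
    {vbar : ∀ ξ : A.Z, Submodule (ResidueField (A.Z.presheaf.stalk ξ)) (CotangentSpace (A.Z.presheaf.stalk ξ))}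
    {IsCanonical : ∀ ξ : A.Z, CampaignW53.HenselianDatum A ξ → Prop} (ξ : A.Z)
    (hξ : ξ ∈ Ec.sing ∩ Literature.AlgebraicGeometry.Hironaka2017.S02Preliminaries.closedPoints A.Z)
    (h : ∀ N : ℕ, ¬ CampaignW53.DatumStratAt ℓ Ec cot vbar IsCanonical ξ N) :
    ¬ CampaignW53StratifiedDatumOf A ℓ Ec cot vbar IsCanonical := by
  rintro ⟨N, hN⟩
  exact h N (hN ξ hξ)

/-- OURS [L1 W5.3 (A)] anchor (pure logic; not a statement of the manuscript). Contrapositive of the weakening anchor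
`campaignW53StratifiedDatumOf_of_enc`: whatever refutes variant (A) at given parameters refutes the enclosure variant
`CampaignW53DatumAfterHenselisationEncOf` at the same parameters (the converse is what K5.3 vs. (A) is about and does
NOT hold in general). [folklore] -/
theorem not_campaignW53DatumAfterHenselisationEncOf_of_not_stratified {p : ℕ} [Fact p.Prime] {K : Type u} [Field K]
    [CharP K p] [PerfectField K] {A : AmbientDatum p K} {ℓ : ℕ} {Ec : IdealExponent A.Z}
    {cot : ∀ η : A.Z, Set (A.Z.presheaf.stalk η)}
    {vbar : ∀ ξ : A.Z, Submodule (ResidueField (A.Z.presheaf.stalk ξ)) (CotangentSpace (A.Z.presheaf.stalk ξ))}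
    {IsCanonical : ∀ ξ : A.Z, CampaignW53.HenselianDatum A ξ → Prop}
    (h : ¬ CampaignW53StratifiedDatumOf A ℓ Ec cot vbar IsCanonical) :
    ¬ CampaignW53DatumAfterHenselisationEncOf A ℓ Ec cot vbar IsCanonical :=
  fun henc => h (campaignW53StratifiedDatumOf_of_enc henc)

end Summit.ResolutionOfSingularities.ResolutionOfSingularities.Theorems

end
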